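import Summits.HodgeConjecture.HodgeConjecture.Theorems.F0P3XiEvpOfRecordSCD      -- ★ A2ᴰ (F0P3a-p01 (g11)): `hSCD_of_cmCharIdentityPackageTest` + PIN `_fst`; A1ᴰ `xiPacketFamilyOfRecordSCD_of_nonsplit`
import HarnessLib

/-!
# Crux `H413`, programme P2 — (D7α) THE SHAPE OF THE SCD RECORD AT A NON-SPLIT PLACE, READ OFF THE TEST PACKAGE
# (record-level pin + [13.1.4] on test functions for the record's own `πˢ`; the H-SHAPE hypothesis of ★ producerᵀ at the record)

Cell `hodgecm-mathlib` (D-0151), FLOOR 0, crux item H413 = `stmt-HodgeConjecture-24833`, route of record `HCCMUnconditional`; programme P2 (D7α owner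
F0P2-p01 (g9)), LEAD F0P3a-plan (g9) T8-36 ∕ T8-37 («TWIN + CERTIFICATE HAND: the record-level pin as a rider by import on A2ᴰ»), desk F0P3-plan (g8) D21
R-43 «SC-CHOOSE», director s765.  Helper file: THEOREMS ONLY (no definition, no named fact, no instance, no notation, no `sorry`);
`--supports stmt-HodgeConjecture-24833 --as helper`.  HONEST LABEL: HC_CM is proved only modulo the printed citations until rung 0 closes; this file
discharges none of them — it reads the closer's Test-package binder `hQT : CMCharIdentityPackageTest …` (the re-typed Q-CM letter, ★ p840183).

WHAT.  ★ A1ᴰ `F0P3XiPacketFamilyOfRecordSCD.xiPacketFamilyOfRecordSCD … μZ keys hSC` is the ξ-local family of record on the supercuspidal partner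
DATUM `hSC` (subtype-valued; ED. 2 of the SC road after the proof-irrelevance finding, certificate 4ee1e2e4), and ★ A2ᴰ
`hSCD_of_cmCharIdentityPackageTest … hQT` is the datum read off the Test package, with PIN `(…).1 = ((hQT ξ).1 v …).πs` (`rfl`).  This file proves,
for the record AT THAT DATUM and every non-split `v`:

* `xiPacketFamilyOfRecordSCD_eq_of_packageTest` — RECORD-LEVEL PIN (an equation, not `rfl`: the record is chosen through the packet-level ∃ of A1ᴰ):
  `∃ T a ha h, record ξ v = ⟨πⁿ ∘ e, some ((hQT ξ).1 v hns T a ha h (μZ v) π₂ πⁿ _ _).πs⟩` with `(π₂, πⁿ) = keys ξ v hns`;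
* `charIdentityAtTest_xiPacketFamilyOfRecordSCD` — [13.1.4] ON TEST FUNCTIONS for the record's own packet at `v`
  (★ `CMNonsplitCharIdentityAtTest.charIdentityAtTest_πs` transported along the pin);
* `shape_xiPacketFamilyOfRecordSCD_of_packageTest` — the H-SHAPE hypothesis of ★ producerᵀ
  `F0P2oD7alphaMemDockOfRowsT.stubD7αMemDockPerMeasureT_of_rows` VERBATIM at `packFin := record`, `ξloc := fun ξ v => ξ.xiLocalChar v`:
  `∃ T a ha h π₂ πⁿ πˢ, Keys ∧ π₂ ∈ L² ∧ πⁿ ∉ L² ∧ πˢ supercuspidal ∧ πˢ ≠ πⁿ∘e ∧ ⟨πⁿ∘e, some πˢ⟩.CharIdentityAtTest … ∧ record ξ v = ⟨πⁿ∘e, some πˢ⟩`.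

References: [Rogawski1990] §12.2 (2) pp. 173–174; §13.1 Prop. 13.1.3 (d), Prop. 13.1.4 p. 199; §13.3 pp. 201–202.
-/

set_option autoImplicit false
-- the mandated namespace repeats `HodgeConjecture.HodgeConjecture`, as in every `Theorems/*.lean` of this sub-problem
set_option linter.dupNamespace false

noncomputable section

open NumberField IsDedekindDomain MeasureTheory
open scoped Matrix

namespace Summit.HodgeConjecture.HodgeConjecture.Cruxes.H413.F0P2oD7alphaShapeOfRecordSCD

open Literature.NumberTheory Literature.NumberTheory.Automorphic Literature.NumberTheory.Automorphic.UnitaryGroup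
open Literature.NumberTheory.Rogawski1990 Literature.NumberTheory.GaloisRepresentations
open Summit.HodgeConjecture.HodgeConjecture.Cruxes.H413.F0P3XiPacketFamilyOfRecordSCD (xiPacketFamilyOfRecordSCD xiPacketFamilyOfRecordSCD_of_nonsplit
  hSCD_of_cmCharIdentityPackageTest)

variable (L : Type) [Field L] [NumberField L] [IsCMField L] (H : Matrix (Fin 3) (Fin 3) L)
  (hH : (H.map (cmConjRingHom L))ᵀ = H) (hHd : IsUnit H.det) (μω : HeckeCharacter L) (hμu : μω.IsUnitary)
  [∀ v : HeightOneSpectrum (𝓞 ↥(maximalRealSubfield L)), MeasurableSpace ((cmDatum L 3 H).Local v)]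
  [∀ v : HeightOneSpectrum (𝓞 ↥(maximalRealSubfield L)),
    MeasurableSpace ((cmDatum L 2 (Matrix.of fun i j : Fin 2 => if i.val + j.val + 1 = 2 then (1 : L) else 0)).Local v ×
      (cmDatum L 1 (Matrix.of fun i j : Fin 1 => if i.val + j.val + 1 = 1 then (1 : L) else 0)).Local v)]
  [∀ (v : HeightOneSpectrum (𝓞 ↥(maximalRealSubfield L)))
      (a : ((cmDatum L 2 (Matrix.of fun i j : Fin 2 => if i.val + j.val + 1 = 2 then (1 : L) else 0)).Local v ×
        (cmDatum L 1 (Matrix.of fun i j : Fin 1 => if i.val + j.val + 1 = 1 then (1 : L) else 0)).Local v)),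
    MeasurableSpace (((cmDatum L 2 (Matrix.of fun i j : Fin 2 => if i.val + j.val + 1 = 2 then (1 : L) else 0)).Local v ×
        (cmDatum L 1 (Matrix.of fun i j : Fin 1 => if i.val + j.val + 1 = 1 then (1 : L) else 0)).Local v) ⧸
      Subgroup.centralizer ({a} : Set ((cmDatum L 2 (Matrix.of fun i j : Fin 2 => if i.val + j.val + 1 = 2 then (1 : L) else 0)).Local v ×
        (cmDatum L 1 (Matrix.of fun i j : Fin 1 => if i.val + j.val + 1 = 1 then (1 : L) else 0)).Local v)))]
  [∀ (v : HeightOneSpectrum (𝓞 ↥(maximalRealSubfield L))) (γ : (cmDatum L 3 H).Local v),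
    MeasurableSpace ((cmDatum L 3 H).Local v ⧸ Subgroup.centralizer ({γ} : Set ((cmDatum L 3 H).Local v)))]
  [∀ v : HeightOneSpectrum (𝓞 ↥(maximalRealSubfield L)), MeasurableSpace (Gqs L v ⧸ Subgroup.center (Gqs L v))]
  (Δ : ∀ v : HeightOneSpectrum (𝓞 ↥(maximalRealSubfield L)), LocalTransferFactor L H v)
  (mH : ∀ v : HeightOneSpectrum (𝓞 ↥(maximalRealSubfield L)),
    OrbitalMeasureFamily ((cmDatum L 2 (Matrix.of fun i j : Fin 2 => if i.val + j.val + 1 = 2 then (1 : L) else 0)).Local v ×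
      (cmDatum L 1 (Matrix.of fun i j : Fin 1 => if i.val + j.val + 1 = 1 then (1 : L) else 0)).Local v))
  (mG : ∀ v : HeightOneSpectrum (𝓞 ↥(maximalRealSubfield L)), OrbitalMeasureFamily ((cmDatum L 3 H).Local v))
  (νG : ∀ v : HeightOneSpectrum (𝓞 ↥(maximalRealSubfield L)), Measure ((cmDatum L 3 H).Local v))
  (νH : ∀ v : HeightOneSpectrum (𝓞 ↥(maximalRealSubfield L)),
    Measure ((cmDatum L 2 (Matrix.of fun i j : Fin 2 => if i.val + j.val + 1 = 2 then (1 : L) else 0)).Local v ×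
      (cmDatum L 1 (Matrix.of fun i j : Fin 1 => if i.val + j.val + 1 = 1 then (1 : L) else 0)).Local v))
  (μZ : ∀ v : HeightOneSpectrum (𝓞 ↥(maximalRealSubfield L)), Measure (Gqs L v ⧸ Subgroup.center (Gqs L v)))
  [∀ v : HeightOneSpectrum (𝓞 ↥(maximalRealSubfield L)), BorelSpace (Gqs L v ⧸ Subgroup.center (Gqs L v))]
  [∀ v : HeightOneSpectrum (𝓞 ↥(maximalRealSubfield L)), (μZ v).IsHaarMeasure]
  (keys : ∀ (ξ : OneDimAutRepH L) (v : HeightOneSpectrum (𝓞 ↥(maximalRealSubfield L))),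
    (∀ w : PlacesOver L v, IsCMField.complexConj L • w.1 = w.1) →
      {p : IrrClass (Gqs L v) × IrrClass (Gqs L v) //
        KeysCaseTwoLabels L v (μω.semilocalComponent L v) (torusLocalComponent L (IsCMField.complexConj L) v ξ.η)
          (torusLocalComponent L (IsCMField.complexConj L) v ξ.ψ) p.1 p.2 ∧
        p.1.IsSquareIntegrable (μZ v) ∧ ¬ p.2.IsSquareIntegrable (μZ v)})
  (hQT : CMCharIdentityPackageTest L H hH hHd νH νG μω hμu Δ mH mG)

/-- **RECORD-LEVEL PIN.**  At a non-split `v`, the SCD record at the Test-package datum is `⟨πⁿ ∘ e, some πˢ⟩` with `πⁿ = (keys ξ v hns).πn` and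
`πˢ = ((hQT ξ).1 v …).πs` THE class read off [13.1.4] on test functions (an equation through A1ᴰ's packet-level choice and A2ᴰ's `rfl` pin).
[cite: Rogawski1990, §12.2 (2) pp. 173–174; §13.1 Prop. 13.1.4 p. 199] -/
theorem xiPacketFamilyOfRecordSCD_eq_of_packageTest (ξ : OneDimAutRepH L) (v : HeightOneSpectrum (𝓞 ↥(maximalRealSubfield L)))
    (hns : ∀ w : PlacesOver L v, IsCMField.complexConj L • w.1 = w.1) :
    ∃ (T : GL (Fin 3) (LocalRing L v)) (a : LocalRing L v) (ha : IsUnit a)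
      (h : formCongr (conjLocal L (IsCMField.complexConj L) v) T (H.map (algebraMap L (LocalRing L v))) =
        a • (Matrix.of fun i j : Fin 3 => if i.val + j.val + 1 = 3 then (1 : L) else 0).map (algebraMap L (LocalRing L v))),
      xiPacketFamilyOfRecordSCD L H hH hHd μω hμu μZ keys
          (hSCD_of_cmCharIdentityPackageTest L H hH hHd μω hμu Δ mH mG νG νH μZ hQT) ξ v =
        ⟨IrrClass.comap (cmDatumLocalCongr L v T ha h).symm (keys ξ v hns).1.2,
          some ((hQT ξ).1 v hns T a ha h (μZ v) (keys ξ v hns).1.1 (keys ξ v hns).1.2 (keys ξ v hns).2.1 (keys ξ v hns).2.2.2).πs⟩ := by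
  obtain ⟨T, a, ha, h, hP, -⟩ := xiPacketFamilyOfRecordSCD_of_nonsplit L H hH hHd μω hμu μZ keys
    (hSCD_of_cmCharIdentityPackageTest L H hH hHd μω hμu Δ mH mG νG νH μZ hQT) ξ v hns
  exact ⟨T, a, ha, h, hP⟩

/-- **[13.1.4] ON TEST FUNCTIONS FOR THE RECORD'S OWN PACKET** at a non-split `v` (★ `CMNonsplitCharIdentityAtTest.charIdentityAtTest_πs` along the pin).
[cite: Rogawski1990, §13.1 Prop. 13.1.3 (d), Prop. 13.1.4 p. 199; §13.3 pp. 201–202] -/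
theorem charIdentityAtTest_xiPacketFamilyOfRecordSCD (ξ : OneDimAutRepH L) (v : HeightOneSpectrum (𝓞 ↥(maximalRealSubfield L)))
    (hns : ∀ w : PlacesOver L v, IsCMField.complexConj L • w.1 = w.1) :
    (xiPacketFamilyOfRecordSCD L H hH hHd μω hμu μZ keys
        (hSCD_of_cmCharIdentityPackageTest L H hH hHd μω hμu Δ mH mG νG νH μZ hQT) ξ v).CharIdentityAtTest L H v
      (fun c f => c.smoothTrace (νG v) f) (ξ.xiLocalChar v) (νH v) (Δ v) (mH v) (mG v) := by
  obtain ⟨T, a, ha, h, hP⟩ := xiPacketFamilyOfRecordSCD_eq_of_packageTest L H hH hHd μω hμu Δ mH mG νG νH μZ keys hQT ξ v hns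
  rw [hP]
  exact ((hQT ξ).1 v hns T a ha h (μZ v) (keys ξ v hns).1.1 (keys ξ v hns).1.2 (keys ξ v hns).2.1 (keys ξ v hns).2.2.2).charIdentityAtTest_πs

/-- **SHAPE OF THE SCD RECORD AT A NON-SPLIT PLACE** — the H-SHAPE hypothesis of ★ producerᵀ `stubD7αMemDockPerMeasureT_of_rows` VERBATIM at
`packFin := xiPacketFamilyOfRecordSCD … (hSCD_of_cmCharIdentityPackageTest … hQT)` and `ξloc ξ v := ξ.xiLocalChar v`: Keys labels, `π₂ ∈ L²`, `πⁿ ∉ L²`,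
`πˢ` supercuspidal and `≠ πⁿ ∘ e`, [13.1.4] on test functions for `⟨πⁿ ∘ e, some πˢ⟩`, and the record IS that packet.
[cite: Rogawski1990, §12.2 (2) pp. 173–174; §13.1 Prop. 13.1.3 (d), Prop. 13.1.4 p. 199] -/
theorem shape_xiPacketFamilyOfRecordSCD_of_packageTest (ξ : OneDimAutRepH L) (v : HeightOneSpectrum (𝓞 ↥(maximalRealSubfield L)))
    (hns : ∀ w : PlacesOver L v, IsCMField.complexConj L • w.1 = w.1) :
    ∃ (T : GL (Fin 3) (LocalRing L v)) (a : LocalRing L v) (ha : IsUnit a)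
      (h : formCongr (conjLocal L (IsCMField.complexConj L) v) T (H.map (algebraMap L (LocalRing L v))) =
        a • (Matrix.of fun i j : Fin 3 => if i.val + j.val + 1 = 3 then (1 : L) else 0).map (algebraMap L (LocalRing L v)))
      (π2 πn : IrrClass (Gqs L v)) (πs : IrrClass ((cmDatum L 3 H).Local v)),
      KeysCaseTwoLabels L v (μω.semilocalComponent L v) (torusLocalComponent L (IsCMField.complexConj L) v ξ.η)
          (torusLocalComponent L (IsCMField.complexConj L) v ξ.ψ) π2 πn ∧
        π2.IsSquareIntegrable (μZ v) ∧ ¬ πn.IsSquareIntegrable (μZ v) ∧ πs.IsSupercuspidal ∧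
        πs ≠ IrrClass.comap (cmDatumLocalCongr L v T ha h).symm πn ∧
        (⟨IrrClass.comap (cmDatumLocalCongr L v T ha h).symm πn, some πs⟩ : CMLocalAPacket L H v).CharIdentityAtTest L H v
          (fun c f => c.smoothTrace (νG v) f) (ξ.xiLocalChar v) (νH v) (Δ v) (mH v) (mG v) ∧
        xiPacketFamilyOfRecordSCD L H hH hHd μω hμu μZ keys
            (hSCD_of_cmCharIdentityPackageTest L H hH hHd μω hμu Δ mH mG νG νH μZ hQT) ξ v =
          ⟨IrrClass.comap (cmDatumLocalCongr L v T ha h).symm πn, some πs⟩ := by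
  obtain ⟨T, a, ha, h, hP⟩ := xiPacketFamilyOfRecordSCD_eq_of_packageTest L H hH hHd μω hμu Δ mH mG νG νH μZ keys hQT ξ v hns
  exact ⟨T, a, ha, h, (keys ξ v hns).1.1, (keys ξ v hns).1.2, _, (keys ξ v hns).2.1, (keys ξ v hns).2.2.1, (keys ξ v hns).2.2.2,
    ((hQT ξ).1 v hns T a ha h (μZ v) (keys ξ v hns).1.1 (keys ξ v hns).1.2 (keys ξ v hns).2.1 (keys ξ v hns).2.2.2).πs_isSupercuspidal,
    ((hQT ξ).1 v hns T a ha h (μZ v) (keys ξ v hns).1.1 (keys ξ v hns).1.2 (keys ξ v hns).2.1 (keys ξ v hns).2.2.2).πs_ne,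
    ((hQT ξ).1 v hns T a ha h (μZ v) (keys ξ v hns).1.1 (keys ξ v hns).1.2 (keys ξ v hns).2.1 (keys ξ v hns).2.2.2).charIdentityAtTest_πs, hP⟩

end Summit.HodgeConjecture.HodgeConjecture.Cruxes.H413.F0P2oD7alphaShapeOfRecordSCD

end
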